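import Summits.NavierStokesRegularity.NavierStokesRegularity.Theorems.TypeIliouvilleNoTypeII.Negative.NSISuperCascadeSingular
import HarnessLib

/-!
# The rate window of the super-similar NSI cascade: `β + γ = 1` and `β ≤ 3/5 ⇔ a²τ³ ≤ 1`

Negative-lane support file for `stmt-NavierStokesRegularity-0056` (model-class REACH of the
counterexample family of `NSISuperCascadeNotTypeI.lean` / `NSISuperCascadeSingular.lean`): for the
generalised glued field with clock `σ`, contraction `τ` and amplitude `a` coupled by the covariance
law `a σ² = τ`, the amplitude exponent `β = log_{σ⁻²} a` of `exists_rate_glueG` (the `j`-th piece has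
size `aʲ ≍ (T₀ - t)^{-β}`) and the length exponent `γ = log_{σ⁻²} τ⁻¹` (the `j`-th piece lives on
balls of radius `≍ τʲ ≍ (T₀ - t)^{γ}`) satisfy, as pure real arithmetic,

* `one_half_lt_rateExp_iff` — `1/2 < β ⇔ 1 < aσ` (the Type-II threshold of `exists_rate_glueG`);
* `rateExp_add_lengthExp_eq_one` — **`β + γ = 1`** (the family lies on the dynamic line of the
  `(β, γ)`-plane: time scale = length scale / amplitude);
* `rateExp_le_three_fifths_iff` — **`β ≤ 3/5 ⇔ a²τ³ ≤ 1`**, the ENERGY CAP (slice energies of the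
  pieces scale like `(a²τ³)ʲ`); with `two_mul_rateExp_le_three_mul_lengthExp_iff` — `2β ≤ 3γ ⇔
  a²τ³ ≤ 1` — this is the line `β + γ = 1` meeting the Leray–Hopf energy half-plane `2β ≤ 3γ` of
  `EnergyCoreEnstrophyWindow.lean` exactly in the segment `β ∈ (1/2, 3/5]`, endpoint `3/5` attained
  iff `a = τ^{-3/2}`.

So the NSI super-cascades with bounded energy exhibit precisely the rates `(T₀ - t)^{-β}`,
`1/2 < β ≤ 3/5`; a candidate mechanism for `TypeIliouvilleNoTypeII` whose obstruction lives at
rates `β > 3/5` is NOT refuted by this model class (kill-kit M2′ reach). No new definitions.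

## References

* W. S. Ożański, arXiv:1709.00602 (2017), §2. [`Ozanski2017NSISingular`]
-/

noncomputable section

set_option linter.dupNamespace false

namespace Summit.NavierStokesRegularity.NavierStokesRegularity.Theorems.TypeIliouvilleNoTypeIINegative

open Literature.Barriers.NavierStokesRegularity Literature.Barriers.NavierStokesRegularity.Scheffer

variable {τ σ a : ℝ}

/-- `σ⁻² > 1` for `0 < σ < 1`. [folklore] -/
private theorem one_lt_base (hσ₀ : 0 < σ) (hσ₁ : σ < 1) : 1 < (σ⁻¹) ^ 2 := by
  have : 1 < σ⁻¹ := (one_lt_inv₀ hσ₀).2 hσ₁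
  nlinarith

/-- `(σ⁻²)^{1/2} = σ⁻¹`. [folklore] -/
private theorem base_rpow_half (hσ₀ : 0 < σ) : ((σ⁻¹) ^ 2) ^ (1 / 2 : ℝ) = σ⁻¹ := by
  rw [← Real.sqrt_eq_rpow, Real.sqrt_sq (inv_pos.2 hσ₀).le]

/-- **Type-II threshold**: `1/2 < β = log_{σ⁻²} a ⇔ 1 < aσ` (`0 < σ < 1`, `0 < a`). [folklore] -/
theorem one_half_lt_rateExp_iff (hσ₀ : 0 < σ) (hσ₁ : σ < 1) (ha : 0 < a) :
    1 / 2 < Real.logb ((σ⁻¹) ^ 2) a ↔ 1 < a * σ := by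
  rw [Real.lt_logb_iff_rpow_lt (one_lt_base hσ₀ hσ₁) ha, base_rpow_half hσ₀,
    ← mul_lt_mul_iff_of_pos_right hσ₀, inv_mul_cancel₀ hσ₀.ne']

/-- **The dynamic line `β + γ = 1`**: under the covariance law `aσ² = τ` the amplitude exponent
`log_{σ⁻²} a` and the length exponent `log_{σ⁻²} τ⁻¹` sum to `1`. [folklore] -/
theorem rateExp_add_lengthExp_eq_one (hσ₀ : 0 < σ) (hσ₁ : σ < 1) (ha : 0 < a)
    (hcov : a * σ ^ 2 = τ) :
    Real.logb ((σ⁻¹) ^ 2) a + Real.logb ((σ⁻¹) ^ 2) τ⁻¹ = 1 := by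
  have hτ : 0 < τ := by rw [← hcov]; positivity
  rw [← Real.logb_mul ha.ne' (inv_ne_zero hτ.ne'), ← hcov, mul_inv, ← mul_assoc,
    mul_inv_cancel₀ ha.ne', one_mul, ← inv_pow, Real.logb_self_eq_one (one_lt_base hσ₀ hσ₁)]

/-- `((σ⁻²)^{3/5})⁵ = σ⁻⁶`. [folklore] -/
private theorem base_rpow_three_fifths_pow_five (hσ₀ : 0 < σ) :
    ((((σ⁻¹) ^ 2) ^ (3 / 5 : ℝ)) ^ 5 : ℝ) = (σ ^ 6)⁻¹ := by
  have hb0 : 0 ≤ (σ⁻¹) ^ 2 := by positivity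
  rw [← Real.rpow_mul_natCast hb0, show (3 / 5 : ℝ) * ((5 : ℕ) : ℝ) = ((3 : ℕ) : ℝ) by norm_num,
    Real.rpow_natCast, inv_pow, inv_pow, ← pow_mul]

/-- `a²τ³ = a⁵σ⁶` under `aσ² = τ`. [folklore] -/
private theorem sq_mul_cube_eq (hcov : a * σ ^ 2 = τ) : a ^ 2 * τ ^ 3 = a ^ 5 * σ ^ 6 := by
  rw [← hcov]; ring

/-- **The energy cap as a rate ceiling**: `β = log_{σ⁻²} a ≤ 3/5 ⇔ a²τ³ ≤ 1` under `aσ² = τ`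
(`a⁵σ⁶ = a²(aσ²)³`). [folklore] -/
theorem rateExp_le_three_fifths_iff (hσ₀ : 0 < σ) (hσ₁ : σ < 1) (ha : 0 < a)
    (hcov : a * σ ^ 2 = τ) :
    Real.logb ((σ⁻¹) ^ 2) a ≤ 3 / 5 ↔ a ^ 2 * τ ^ 3 ≤ 1 := by
  have hb := one_lt_base hσ₀ hσ₁
  have hB : 0 ≤ ((σ⁻¹) ^ 2) ^ (3 / 5 : ℝ) := Real.rpow_nonneg (by positivity) _
  rw [Real.logb_le_iff_le_rpow hb ha, ← pow_le_pow_iff_left₀ ha.le hB (by norm_num : (5 : ℕ) ≠ 0),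
    base_rpow_three_fifths_pow_five hσ₀, sq_mul_cube_eq hcov, ← one_div,
    le_div_iff₀ (by positivity)]

/-- … and as a rate floor: `3/5 ≤ β ⇔ 1 ≤ a²τ³`. [folklore] -/
theorem three_fifths_le_rateExp_iff (hσ₀ : 0 < σ) (hσ₁ : σ < 1) (ha : 0 < a)
    (hcov : a * σ ^ 2 = τ) :
    3 / 5 ≤ Real.logb ((σ⁻¹) ^ 2) a ↔ 1 ≤ a ^ 2 * τ ^ 3 := by
  have hb := one_lt_base hσ₀ hσ₁
  have hB : 0 ≤ ((σ⁻¹) ^ 2) ^ (3 / 5 : ℝ) := Real.rpow_nonneg (by positivity) _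
  rw [Real.le_logb_iff_rpow_le hb ha, ← pow_le_pow_iff_left₀ hB ha.le (by norm_num : (5 : ℕ) ≠ 0),
    base_rpow_three_fifths_pow_five hσ₀, sq_mul_cube_eq hcov, ← one_div,
    div_le_iff₀ (by positivity)]

/-- **Endpoint**: `β = 3/5` exactly at the cap `a²τ³ = 1` (i.e. `a = τ^{-3/2}`). [folklore] -/
theorem rateExp_eq_three_fifths_iff (hσ₀ : 0 < σ) (hσ₁ : σ < 1) (ha : 0 < a)
    (hcov : a * σ ^ 2 = τ) :
    Real.logb ((σ⁻¹) ^ 2) a = 3 / 5 ↔ a ^ 2 * τ ^ 3 = 1 := by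
  rw [le_antisymm_iff, le_antisymm_iff, rateExp_le_three_fifths_iff hσ₀ hσ₁ ha hcov,
    three_fifths_le_rateExp_iff hσ₀ hσ₁ ha hcov]

/-- **The same ceiling in the `(β, γ)`-plane**: `2β ≤ 3γ ⇔ a²τ³ ≤ 1` (with `β + γ = 1` this is
`β ≤ 3/5`); `2β ≤ 3γ` is the Leray–Hopf energy half-plane of `EnergyCoreEnstrophyWindow.lean`.
[folklore] -/
theorem two_mul_rateExp_le_three_mul_lengthExp_iff (hσ₀ : 0 < σ) (hσ₁ : σ < 1) (ha : 0 < a)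
    (hcov : a * σ ^ 2 = τ) :
    2 * Real.logb ((σ⁻¹) ^ 2) a ≤ 3 * Real.logb ((σ⁻¹) ^ 2) τ⁻¹ ↔ a ^ 2 * τ ^ 3 ≤ 1 := by
  have h1 := rateExp_add_lengthExp_eq_one hσ₀ hσ₁ ha hcov
  rw [← rateExp_le_three_fifths_iff hσ₀ hσ₁ ha hcov]
  constructor <;> intro h <;> linarith

/-- **Rate window of the glued field** (model-class reach): for an NSI block and cascade
parameters with `0 < σ < 1`, `aσ² = τ`, `1 < aσ` and the energy cap `a²τ³ ≤ 1`, the rate exponent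
of `exists_rate_glueG` can be taken in `(1/2, 3/5]`: there are `β ∈ (1/2, 3/5]` and `c > 0` with
`c (T₀ - t)^{-β} ≤ ‖𝔲(t, x)‖` somewhere at every `t ∈ [0, T₀)`. [cite: Ozanski2017NSISingular, §2] -/
theorem exists_rate_glueG_mem_window {T ν₀ : ℝ} {z : EuclideanSpace ℝ (Fin 3)}
    {G : Set (EuclideanSpace ℝ (Fin 3))}
    {u : ℝ → EuclideanSpace ℝ (Fin 3) → EuclideanSpace ℝ (Fin 3)}
    (h : IsNSIBlock T ν₀ τ z G u) (hσ₀ : 0 < σ)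
    (hσ₁ : σ < 1) (hcov : a * σ ^ 2 = τ) (haσ : 1 < a * σ) (hcap : a ^ 2 * τ ^ 3 ≤ 1) :
    ∃ β c : ℝ, 1 / 2 < β ∧ β ≤ 3 / 5 ∧ 0 < c ∧
      ∀ t ∈ Set.Ico 0 (blowupTime T σ), ∃ x,
        c * (blowupTime T σ - t) ^ (-β) ≤
          ‖glueG T σ τ a z u t x‖ := by
  have ha : 0 < a := (mul_pos_iff_of_pos_right hσ₀).1 (zero_lt_one.trans haσ)
  obtain ⟨β, c, hβ, hc, hrate⟩ := exists_rate_glueG h hσ₀ hσ₁ haσ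
  -- the exponent produced by `exists_rate_glueG` may be anything `> 1/2`; shrink it to the window
  set β₀ : ℝ := Real.logb ((σ⁻¹) ^ 2) a with hβ₀
  have hβ₀half : 1 / 2 < β₀ := (one_half_lt_rateExp_iff hσ₀ hσ₁ ha).2 haσ
  have hβ₀cap : β₀ ≤ 3 / 5 := (rateExp_le_three_fifths_iff hσ₀ hσ₁ ha hcov).2 hcap
  set β' : ℝ := min β β₀ with hβ'
  have hT₀ : 0 < blowupTime T σ := div_pos h.T_pos (by nlinarith)
  -- `(T₀ - t)^{-β'} ≤ max 1 T₀^{β - β'} (T₀ - t)^{-β}` on `[0, T₀)`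
  refine ⟨β', c * min 1 ((blowupTime T σ) ^ (β' - β)), lt_min hβ hβ₀half,
    (min_le_right _ _).trans hβ₀cap, by positivity, fun t ht => ?_⟩
  obtain ⟨x, hx⟩ := hrate t ht
  refine ⟨x, le_trans ?_ hx⟩
  have hd : 0 < blowupTime T σ - t := sub_pos.2 ht.2
  have hdle : blowupTime T σ - t ≤ blowupTime T σ := by linarith [ht.1]
  -- `(T₀-t)^{-β'} = (T₀-t)^{β-β'} (T₀-t)^{-β} ≤ T₀^{β-β'} (T₀-t)^{-β}` since `β - β' ≥ 0`
  have hsplit : (blowupTime T σ - t) ^ (-β') =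
      (blowupTime T σ - t) ^ (β - β') * (blowupTime T σ - t) ^ (-β) := by
    rw [← Real.rpow_add hd]; ring_nf
  have hmono : (blowupTime T σ - t) ^ (β - β') ≤ (blowupTime T σ) ^ (β - β') :=
    Real.rpow_le_rpow hd.le hdle (sub_nonneg.2 (min_le_left _ _))
  have hmin : min 1 ((blowupTime T σ) ^ (β' - β)) * (blowupTime T σ) ^ (β - β') ≤ 1 := by
    calc min 1 ((blowupTime T σ) ^ (β' - β)) * (blowupTime T σ) ^ (β - β')
        ≤ (blowupTime T σ) ^ (β' - β) * (blowupTime T σ) ^ (β - β') :=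
          mul_le_mul_of_nonneg_right (min_le_right _ _) (Real.rpow_nonneg hT₀.le _)
      _ = 1 := by rw [← Real.rpow_add hT₀]; ring_nf; exact Real.rpow_zero _
  calc c * min 1 ((blowupTime T σ) ^ (β' - β)) * (blowupTime T σ - t) ^ (-β')
      = c * (blowupTime T σ - t) ^ (-β) *
          (min 1 ((blowupTime T σ) ^ (β' - β)) * (blowupTime T σ - t) ^ (β - β')) := by
        rw [hsplit]; ring
    _ ≤ c * (blowupTime T σ - t) ^ (-β) *
          (min 1 ((blowupTime T σ) ^ (β' - β)) * (blowupTime T σ) ^ (β - β')) := by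
        gcongr
    _ ≤ c * (blowupTime T σ - t) ^ (-β) * 1 := by gcongr
    _ = c * (blowupTime T σ - t) ^ (-β) := mul_one _

end Summit.NavierStokesRegularity.NavierStokesRegularity.Theorems.TypeIliouvilleNoTypeIINegative

end
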